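import Summits.BirchSwinnertonDyer.BirchSwinnertonDyer.Theorems.SignedLowerHalvesSmallImageLowerHalfBothSignsRttD2SeqSemilocAssembly
import Summits.BirchSwinnertonDyer.BirchSwinnertonDyer.Theorems.SignedLowerHalvesSmallImageLowerHalfBothSignsRttD2SeqSemilocGenerator
import Summits.BirchSwinnertonDyer.BirchSwinnertonDyer.Theorems.SignedLowerHalvesSmallImageLowerHalfBothSignsRttD2SeqSemilocFiniteFrame
import Summits.BirchSwinnertonDyer.BirchSwinnertonDyer.Theorems.SignedLowerHalvesSmallImageLowerHalfBothSignsRttD2SeqJ3HS2Plumb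
import HarnessLib

/-!
# Route `SignedLowerHalves`, crux L `SmallImageLowerHalfBothSigns` (stmt-BirchSwinnertonDyer-23599), line `rtt_w3` v32 — stub S3β″ (`stub_junctionPT_ns`, row J4′, Poitou–Tate half):
# ★★★ S3β″ FRAME-PLUMBED MODULO THE UNRAMIFIED GENERATORS — `λ(Λ_𝒪 ⧸ (E)) ≤ λ(Y″) + λ(I.H ⧸ B′)` ON THE SKELETON'S Γ-BINDERS, GIVEN ONLY `hgen`

WIDTH seat `bsd-line-slh-p3-w3` g27 under LEAD `cruxlead-stmt-BirchSwinnertonDyer-23599` g14 (cell `bsd-ssimc`; LEAD REQUEST 2026-08-31T09:34Z); helper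
`--supports stmt-BirchSwinnertonDyer-23599`. THEOREMS ONLY (no definition, no named fact, no instance, no `sorry`). HONEST FRAMING: bookkeeping — the composition
«g26 N5-(iii) `lambdaInvariant_quotient_span_le_unramifiedFamilies_of_generators` (p818109) ∘ g26 PT-half `lambdaInvariant_unramifiedFamilies_le` (p816814), with N5-(i)
`moduleFinite_and_isTorsion_pi_semiloc_of_cyclotomic` (p818290)», every frame hypothesis discharged by g25's plumbing dictionary (`…RttD2SeqJ3HS2Plumb`, p809825) exactly as in
S2: `hpv`, `hvP`, `hvS₀`, `hPS₀` ((R)+`hθ`+`hbad`+`hS₀bad`), `hP`/`hS₀` finite, `hNP`, `hθN` ((U)); the perfect `λ` (`exists_lam_perfect`), the global coefficient pairing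
`cofreeLamCoeffPairingK` with `hperf := bijective_flip_cofreeLamCoeffPairingK`, the layer pairing `layerPairingOf …` at a local generator `γv` (which EXISTS because `vp` is non-split,
`isNonsplitIn_restrictOfFinrankEqTwo`), and `P_w ≠ 0` FROM `hgen` ITSELF (an element with annihilator `(0)` cannot live in the `Λ`-torsion module `Π_{w∈S₀K} 𝐇¹_{Iw,w}`).
The ONE displayed hypothesis `hgen` — one unramified generator `u_w ∈ 𝐇¹_{Iw,w}` with `Ann_{Λ_𝒪}(u_w) = (P_w)` per `w ∈ T` — is NOT proved here; S3β″, crux L and BSD remain OPEN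
and are proved for NO curve.

* `cofreeLamCoeffPairingK_hPsc` — the `𝒪`-balance of the global `λ`-pairing (the `hPsc` binder of p816814).
* `ne_zero_of_annihilator_eq_span_of_isTorsion` — `Ann(u) = (P)` inside a `Λ`-torsion product forces `P ≠ 0`.
* ★★★ `lambdaInvariant_quotient_junctionDepletion_le_of_generators` — the registered `stub_junctionPT_ns` conclusion with `JunctionDepletion`, `JunctionLamY2`, `JunctionCarrier`
  UNFOLDED, from the Γ-binders of the stub and `hgen`.
References: [Rubin2000] Thm. 1.7.3, §4.2, App. B.3; [Kobayashi2003] Thm. 7.3 i); [PerrinRiou1994Invent] §1.3; [GreenbergVatsal2000] §2 Prop. (2.4); [Washington1997] §13.2;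
[NeukirchSchmidtWingberg2008] (7.2.6), (8.6.2)–(8.6.3).
-/

set_option autoImplicit false
set_option linter.dupNamespace false -- D-0017: single-problem summit, the namespace repeats the problem name by design
noncomputable section

open scoped Classical
open NumberField IsDedekindDomain Field Matrix CategoryTheory Function Rat.HeightOneSpectrum

namespace Summit.BirchSwinnertonDyer.BirchSwinnertonDyer.Theorems.SmallImageRttD2Seq

open Literature.NumberTheory.EllipticCurves Literature.NumberTheory.EllipticCurves.GreenbergSelmer Literature.NumberTheory.GaloisRepresentations
  Literature.NumberTheory.GaloisRepresentations.DiscreteGaloisModule Literature.NumberTheory.GaloisCohomology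
  Literature.NumberTheory.EllipticCurves.GreenbergVatsal2000 Literature.NumberTheory.ComplexMultiplication.EllipticUnits.JohnsonLeungKings2011
  Summit.BirchSwinnertonDyer.BirchSwinnertonDyer.Theorems.SmallImageCharSignedSelmer Summit.BirchSwinnertonDyer.BirchSwinnertonDyer.Theorems.SmallImageRttD2J1

/-! ## §1. Two small inputs -/

section Inputs

variable {K : Type} [Field K] [NumberField K] {p : ℕ} [Fact p.Prime] (S : Set (PadicAlgCl p)) (lam : padicCoeffIntegers S →+ ℤ_[p])
  (hlam : ∀ (c : ℤ_[p]) (y : padicCoeffIntegers S), lam (padicIntToCoeffIntegers S c * y) = c * lam y)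
  (θ' : absoluteGaloisGroup K →ₜ* (padicCoeffIntegers S)ˣ) (P : Set (HeightOneSpectrum (𝓞 K))) (θ : FramedGaloisRep K (padicCoeffIntegers S) 1)
  (hstabK : ∀ m : Cofree θ (padicCoeffField S), IsOpen (MulAction.stabilizer (absoluteGaloisGroup K) m : Set (absoluteGaloisGroup K)))
  (hθ : ∀ σ : absoluteGaloisGroup K,
    ((θ' σ : (padicCoeffIntegers S)ˣ) : padicCoeffIntegers S) * ((θ σ : GL (Fin 1) (padicCoeffIntegers S)) : Matrix (Fin 1) (Fin 1) (padicCoeffIntegers S)) 0 0 = 1)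

/-- `hPsc` for the GLOBAL `λ`-pairings `cofreeLamCoeffPairingK` (the binder of p816814 verbatim): the `𝒪`-balance `⟪(a ⊗ id) x, m⟫ = ⟪x, a·m⟫` (same bilinear map as the local
pairing, `cofreeLamPairing_oMuScalar`). [cite: Rubin2000, §4.2] -/
theorem cofreeLamCoeffPairingK_hPsc (k : ℕ) (a : padicCoeffIntegers S)
    (x : ↥(Representation.invariants ((muTwistO S θ' k).toRepresentation.comp (ramificationSubgroup K P).subtype)))
    (m : ↥(torsionPow (Cofree θ (padicCoeffField S)) p k)) :
    (cofreeLamCoeffPairingK S lam hlam θ' P θ hstabK hθ k).toLin (coeffMapO S P θ' (oMuScalar S (p ^ k) a) (oMuScalar_muTwistO S θ' k a) x) m =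
      (cofreeLamCoeffPairingK S lam hlam θ' P θ hstabK hθ k).toLin x (a • m) := by
  rw [cofreeLamCoeffPairingK_toLin, cofreeLamCoeffPairingK_toLin]
  exact cofreeLamPairing_oMuScalar S K lam hlam θ k a (x : OMuCarrier K S (p ^ k)) m

variable {S} in
/-- **`Ann_{Λ_𝒪}(u) = (P)` for a component `u` of a `Λ`-TORSION product forces `P ≠ 0`**: a regular `a ∈ Λ` with `a • u = 0` gives `ι a ∈ (P)`, and `ι a ≠ 0`.
(So the unramified-generator hypothesis `hgen` of S3β″ already carries `P_w ≠ 0`; no `x_w ≠ 0` is needed.) [cite: Washington1997, §13.2] [folklore] -/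
theorem ne_zero_of_annihilator_eq_span_of_isTorsion {κ : ZpExtension K p} {γ : absoluteGaloisGroup K} {S₀ : Set (HeightOneSpectrum (𝓞 K))}
    (htors : letI : ∀ w : HeightOneSpectrum (𝓞 K), Module (IwasawaAlgebra p) (semilocIwasawaCohomologyDataO S κ γ θ' P w 1).H :=
        fun w ↦ (semilocIwasawaCohomologyDataO S κ γ θ' P w 1).moduleIwasawa
      Module.IsTorsion (IwasawaAlgebra p) (∀ w : S₀, (semilocIwasawaCohomologyDataO S κ γ θ' P w 1).H))
    {w : HeightOneSpectrum (𝓞 K)} (hw : w ∈ S₀) (u : (semilocIwasawaCohomologyDataO S κ γ θ' P w 1).H) (Pw : IwasawaAlgebraO S)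
    (hann : ∀ f : IwasawaAlgebraO S, f • u = 0 ↔ f ∈ Ideal.span {Pw}) : Pw ≠ 0 := by
  letI : ∀ w : HeightOneSpectrum (𝓞 K), Module (IwasawaAlgebra p) (semilocIwasawaCohomologyDataO S κ γ θ' P w 1).H :=
    fun w ↦ (semilocIwasawaCohomologyDataO S κ γ θ' P w 1).moduleIwasawa
  letI : Algebra (IwasawaAlgebra p) (IwasawaAlgebraO S) := (iwasawaToIwasawaO S).toAlgebra
  haveI : ∀ w : HeightOneSpectrum (𝓞 K), IsScalarTower (IwasawaAlgebra p) (IwasawaAlgebraO S) (semilocIwasawaCohomologyDataO S κ γ θ' P w 1).H :=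
    fun w ↦ (semilocIwasawaCohomologyDataO S κ γ θ' P w 1).isScalarTower_moduleIwasawa
  intro hP
  obtain ⟨a, ha⟩ := @htors (Pi.single (M := fun v : S₀ ↦ (semilocIwasawaCohomologyDataO S κ γ θ' P v 1).H) ⟨w, hw⟩ u)
  have hau : (a : IwasawaAlgebra p) • u = 0 := by
    have h := congr_fun ha ⟨w, hw⟩
    rwa [Pi.smul_apply, Pi.single_eq_same, Pi.zero_apply] at h
  have hιa : iwasawaToIwasawaO S (a : IwasawaAlgebra p) • u = 0 := by
    rw [← hau, ← algebraMap_smul (IwasawaAlgebraO S) (a : IwasawaAlgebra p) u]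
    rfl
  have hmem := (hann _).1 hιa
  rw [hP, Ideal.span_singleton_zero, Ideal.mem_bot] at hmem
  -- `Λ → Λ_𝒪` is injective (coefficientwise `ℤ_p ⊆ ℚ_p ⊆ ℚ̄_p`)
  have hinjO : Function.Injective (padicIntToCoeffIntegers S) := fun a b h ↦ by
    have h' := congrArg (fun x : ↥(padicCoeffIntegers S) ↦ (x : PadicAlgCl p)) h
    simp only [coe_padicIntToCoeffIntegers] at h'
    exact Subtype.ext ((algebraMap ℚ_[p] (PadicAlgCl p)).injective h')
  have hinj : Function.Injective (iwasawaToIwasawaO S (p := p)) := PowerSeries.map_injective _ hinjO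
  exact nonZeroDivisors.coe_ne_zero a (hinj (hmem.trans (map_zero _).symm))

end Inputs

/-! ## §2. S3β″ frame-plumbed modulo the unramified generators -/

section S3beta

set_option maxHeartbeats 1600000 in
/-- ★★★ **S3β″ (`stub_junctionPT_ns`, line `rtt_w3` v32) ON THE SKELETON'S Γ-BINDERS, MODULO THE UNRAMIFIED GENERATORS.** For the cyclotomic `κ` of `ℚ` (generator `γ`,
cyclotomic variable) restricted to the quadratic `K` (`p ≠ 2`, `p ∤ d_K`, `vp = (p)` inert), the frame `(θ′, 𝔣)` with `θ′·θ₀₀ = 1`, `𝔣 ≠ 0` and the support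
conditions (R)/(U), the curve/character clauses `hθ` (unramified off `p𝔪`), `hbad`, `hS₀bad`, `hS₀p`, the dual datum `Dψ` (finitely generated torsion), honda's cyclotomic model `I`
(orientation `γK⁻¹`) and a finite set `T ⊆ S₀K` with Frobenius data `(φ, x, d)`: IF every `w ∈ T` carries `u_w ∈ 𝐇¹_{Iw,w}` (constructed semilocal data) unramified at every level with
EXACT annihilator `Ann_{Λ_𝒪}(u_w) = (P_w)`, `P_w = ι((1+T)^{x_w}) − C(θ′(φ_w)·χ_cyc(φ_w))` (`hgen`), THEN
`λ(Λ_𝒪 ⧸ (C(p^d)·∏_{w∈T} P_w)) ≤ λ(Y″) + λ(I.H ⧸ range B′.subtype)` — the registered conclusion with `JunctionDepletion`, `JunctionLamY2` (`Y″` = lambda-p1's localisation-image dual at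
`vp`, `S₁ = S₀K ∪ {w ∣ p}`) and `JunctionCarrier` (`B′ = strictCarrier I (strictLevel … S₀K)`) unfolded. Proof: `le_trans` of g26's local count (p818109) and PT-half (p816814), all side
inputs discharged as listed in the file header. [cite: Rubin2000, Thm. 1.7.3, §4.2, App. B.3] [cite: Kobayashi2003, Thm. 7.3 i)] [cite: PerrinRiou1994Invent, §1.3]
[cite: GreenbergVatsal2000, §2 Prop. (2.4)] [cite: Washington1997, §13.2] -/
theorem lambdaInvariant_quotient_junctionDepletion_le_of_generators
    {p : ℕ} [Fact p.Prime] (hp : p ≠ 2) {κ : ZpExtension ℚ p} (hκ : κ.IsCyclotomic) {γ : absoluteGaloisGroup ℚ} (hγ : κ.IsTopGenerator γ) (hcv : IsCyclotomicVariable p γ)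
    {K : Type} [Field K] [NumberField K] (hK2 : Module.finrank ℚ K = 2) (hnd : ¬ (p : ℤ) ∣ NumberField.discr K)
    (S : Set (PadicAlgCl p)) (hS : 0 < Module.finrank ℚ_[p] (padicCoeffField S)) (θ : FramedGaloisRep K (padicCoeffIntegers S) 1) (W : WeierstrassCurve ℚ)
    (j : (W.baseChange K).geomPrimaryTorsion p →+ Cofree θ (padicCoeffField S)) (ε : ℤˣ)
    {γK : absoluteGaloisGroup K} (hγK : (κ.restrictOfFinrankEqTwo hp K hK2).IsTopGenerator γK)
    (S₀ : Finset (HeightOneSpectrum (𝓞 ℚ))) (hS₀p : ∀ v ∈ S₀, ((p : ℕ) : 𝓞 ℚ) ∉ v.asIdeal)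
    (hS₀bad : ∀ v : HeightOneSpectrum (𝓞 ℚ), ¬ W.HasGoodReductionAt v → v ∈ S₀) {𝔪 : Ideal (𝓞 K)}
    (hbad : ∀ (ℓ : ℕ) [Fact ℓ.Prime], ℓ ∣ (NumberField.discr K).natAbs * Ideal.absNorm 𝔪 → ¬ W.HasGoodReductionAtPrime ℓ)
    (hθunr : ∀ w : HeightOneSpectrum (𝓞 K), (p : 𝓞 K) ∉ w.asIdeal → ¬ 𝔪 ≤ w.asIdeal → FramedGaloisRep.IsUnramifiedAt w θ)
    (D : SignedTransportDualDataSat (κ.restrictOfFinrankEqTwo hp K hK2) γK (Cofree θ (padicCoeffField S)) (padicCoeffIntegers S) (W.baseChange K) j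
      {w : HeightOneSpectrum (𝓞 K) | ∃ v ∈ S₀, ((natGenerator v : ℕ) : 𝓞 K) ∈ w.asIdeal} ε)
    (hDfin : Module.Finite (IwasawaAlgebra p) D.X) (hDtor : Module.IsTorsion (IwasawaAlgebra p) D.X)
    (vp : HeightOneSpectrum (𝓞 K)) (hv : vp.asIdeal = Ideal.span {((p : ℕ) : 𝓞 K)})
    {θ' : absoluteGaloisGroup K →ₜ* (padicCoeffIntegers S)ˣ} {𝔣 : Ideal (𝓞 K)} (h𝔣 : 𝔣 ≠ ⊥)
    (hθ'θ : ∀ g : absoluteGaloisGroup K, ((θ' g : (padicCoeffIntegers S)ˣ) : padicCoeffIntegers S) *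
      ((θ g : GL (Fin 1) (padicCoeffIntegers S)) : Matrix (Fin 1) (Fin 1) (padicCoeffIntegers S)) 0 0 = 1)
    (hR : ∀ w ∈ suppPF p 𝔣, ((p : ℕ) : 𝓞 K) ∉ w.asIdeal → ∃ 𝔓 ∈ w.primesAbove, ∃ τ ∈ 𝔓.inertia (absoluteGaloisGroup K), θ' τ ≠ 1)
    (hU : ∀ w : HeightOneSpectrum (𝓞 K), w ∉ suppPF p 𝔣 → ∀ 𝔓 ∈ w.primesAbove, ∀ τ ∈ 𝔓.inertia (absoluteGaloisGroup K), θ' τ = 1)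
    (I : CycIwasawaCohomologyDataO S (κ.restrictOfFinrankEqTwo hp K hK2) γK⁻¹ θ' (suppPF p 𝔣) 1)
    (T : Finset (HeightOneSpectrum (𝓞 K))) (φ : HeightOneSpectrum (𝓞 K) → absoluteGaloisGroup K) (x : HeightOneSpectrum (𝓞 K) → ℤ_[p]) (d : ℕ)
    (hT : ∀ w, w ∈ T ↔ (w ∈ {w : HeightOneSpectrum (𝓞 K) | ∃ v ∈ S₀, ((natGenerator v : ℕ) : 𝓞 K) ∈ w.asIdeal} ∧ w ∉ suppPF p 𝔣))
    (hgen : haveI : FiniteDimensional ℚ_[p] (padicCoeffField S) := Module.finite_of_finrank_pos hS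
      ∀ w ∈ T, ∃ u : (semilocIwasawaCohomologyDataO S (κ.restrictOfFinrankEqTwo hp K hK2) γK⁻¹ θ' (suppPF p 𝔣) w 1).H,
        (∀ f : IwasawaAlgebraO S, f • u = 0 ↔ f ∈ Ideal.span {iwasawaToIwasawaO S (PowerSeries.binomialSeries ℤ_[p] (x w)) -
          PowerSeries.C (((θ' (φ w) : (padicCoeffIntegers S)ˣ) : padicCoeffIntegers S) *
            padicIntToCoeffIntegers S ((GaloisRep.cyclotomicCharacter K p (φ w) : ℤ_[p]ˣ) : ℤ_[p]))}) ∧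
        ∀ n k : ℕ, (semilocIwasawaCohomologyDataO S (κ.restrictOfFinrankEqTwo hp K hK2) γK⁻¹ θ' (suppPF p 𝔣) w 1).proj n k u ∈
          unramifiedLevelΛ S (κ.restrictOfFinrankEqTwo hp K hK2) γK⁻¹ θ' (suppPF p 𝔣) w n k) :
    haveI : FiniteDimensional ℚ_[p] (padicCoeffField S) := Module.finite_of_finrank_pos hS
    letI : Algebra (IwasawaAlgebra p) (IwasawaAlgebraO S) := (iwasawaToIwasawaO S).toAlgebra
    letI := I.moduleIwasawa
    haveI := I.isScalarTower_moduleIwasawa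
    lambdaInvariant p (IwasawaAlgebraO S ⧸ Ideal.span {PowerSeries.C ((p : padicCoeffIntegers S) ^ d) *
        ∏ w ∈ T, (iwasawaToIwasawaO S (PowerSeries.binomialSeries ℤ_[p] (x w)) -
          PowerSeries.C (((θ' (φ w) : (padicCoeffIntegers S)ˣ) : padicCoeffIntegers S) *
            padicIntToCoeffIntegers S ((GaloisRep.cyclotomicCharacter K p (φ w) : ℤ_[p]ˣ) : ℤ_[p])))}) ≤
      (letI := localAction (closureEmb (K := K) (vp.adicCompletion K)) (Cofree θ (padicCoeffField S))
       @lambdaInvariant p _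
        (locImageQuot (κ.restrictOfFinrankEqTwo hp K hK2) (Cofree θ (padicCoeffField S)) (padicCoeffIntegers S) (W.baseChange K) j
            {w : HeightOneSpectrum (𝓞 K) | ∃ v ∈ S₀, ((natGenerator v : ℕ) : 𝓞 K) ∈ w.asIdeal} ε vp (fun _ _ ↦ rfl) (natCast_mem_asIdeal_of_eq_span hv)
            ({w : HeightOneSpectrum (𝓞 K) | ∃ v ∈ S₀, ((natGenerator v : ℕ) : 𝓞 K) ∈ w.asIdeal} ∪ {w : HeightOneSpectrum (𝓞 K) | ((p : ℕ) : 𝓞 K) ∈ w.asIdeal}) →+ AddCircle (1 : ℚ)) _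
        (locImageDualModule (κ.restrictOfFinrankEqTwo hp K hK2) (padicCoeffIntegers S) (W.baseChange K) j
          {w : HeightOneSpectrum (𝓞 K) | ∃ v ∈ S₀, ((natGenerator v : ℕ) : 𝓞 K) ∈ w.asIdeal} ε vp (fun _ _ ↦ rfl) (natCast_mem_asIdeal_of_eq_span hv)
          ({w : HeightOneSpectrum (𝓞 K) | ∃ v ∈ S₀, ((natGenerator v : ℕ) : 𝓞 K) ∈ w.asIdeal} ∪ {w : HeightOneSpectrum (𝓞 K) | ((p : ℕ) : 𝓞 K) ∈ w.asIdeal})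
          (isNonsplitIn_restrictOfFinrankEqTwo hp hκ K hK2 hnd (natCast_mem_asIdeal_of_eq_span hv))
          (GreenbergSelmer.exists_pow_smul_cofree_eq_zero S θ) (GreenbergSelmer.isOpen_stabilizer_cofree S θ) hγK)) +
        lambdaInvariant p (I.H ⧸ LinearMap.range (Submodule.subtype
          (strictCarrier I (strictLevel S (κ.restrictOfFinrankEqTwo hp K hK2) θ' (suppPF p 𝔣) {w : HeightOneSpectrum (𝓞 K) | ∃ v ∈ S₀, ((natGenerator v : ℕ) : 𝓞 K) ∈ w.asIdeal})
            (fun n k f _ hy ↦ smul_mem_strictLevel S (κ.restrictOfFinrankEqTwo hp K hK2) θ' (suppPF p 𝔣)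
              {w : HeightOneSpectrum (𝓞 K) | ∃ v ∈ S₀, ((natGenerator v : ℕ) : 𝓞 K) ∈ w.asIdeal} γK⁻¹ n k f hy)))) := by
  haveI : FiniteDimensional ℚ_[p] (padicCoeffField S) := Module.finite_of_finrank_pos hS
  haveI := hDfin
  letI : Algebra (IwasawaAlgebra p) (IwasawaAlgebraO S) := (iwasawaToIwasawaO S).toAlgebra
  letI := localAction (closureEmb (K := K) (vp.adicCompletion K)) (Cofree θ (padicCoeffField S))
  haveI := smulCommClass_localAction (R := padicCoeffIntegers S) (Cofree θ (padicCoeffField S)) vp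
  letI := I.moduleIwasawa
  haveI := I.isScalarTower_moduleIwasawa
  letI : ∀ w : HeightOneSpectrum (𝓞 K), Module (IwasawaAlgebra p) (semilocIwasawaCohomologyDataO S (κ.restrictOfFinrankEqTwo hp K hK2) γK⁻¹ θ' (suppPF p 𝔣) w 1).H :=
    fun w ↦ (semilocIwasawaCohomologyDataO S (κ.restrictOfFinrankEqTwo hp K hK2) γK⁻¹ θ' (suppPF p 𝔣) w 1).moduleIwasawa
  haveI : ∀ w : HeightOneSpectrum (𝓞 K), IsScalarTower (IwasawaAlgebra p) (IwasawaAlgebraO S) (semilocIwasawaCohomologyDataO S (κ.restrictOfFinrankEqTwo hp K hK2) γK⁻¹ θ' (suppPF p 𝔣) w 1).H :=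
    fun w ↦ (semilocIwasawaCohomologyDataO S (κ.restrictOfFinrankEqTwo hp K hK2) γK⁻¹ θ' (suppPF p 𝔣) w 1).isScalarTower_moduleIwasawa
  -- the frame-plumbing dictionary (g25, p809825)
  have hvp : ((p : ℕ) : 𝓞 K) ∈ vp.asIdeal := natCast_mem_asIdeal_of_eq_span hv
  have hpv : ∀ w : HeightOneSpectrum (𝓞 K), ((p : ℕ) : 𝓞 K) ∈ w.asIdeal → w = vp := eq_of_natCast_mem_asIdeal_of_eq_span hv
  have hvP : vp ∈ (suppPF p 𝔣) := mem_suppPF_of_eq_span 𝔣 hv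
  have hvS₀ : vp ∉ {w : HeightOneSpectrum (𝓞 K) | ∃ v ∈ S₀, ((natGenerator v : ℕ) : 𝓞 K) ∈ w.asIdeal} := not_mem_placesAboveFinset_of_eq_span S₀ hS₀p hv
  have hS₀Kfin : {w : HeightOneSpectrum (𝓞 K) | ∃ v ∈ S₀, ((natGenerator v : ℕ) : 𝓞 K) ∈ w.asIdeal}.Finite := finite_placesAboveFinset S₀
  have hPfin : (suppPF p 𝔣).Finite := finite_suppPF_of_ne_bot h𝔣
  have hPS₀ : ∀ w ∈ (suppPF p 𝔣), w ∉ {w : HeightOneSpectrum (𝓞 K) | ∃ v ∈ S₀, ((natGenerator v : ℕ) : 𝓞 K) ∈ w.asIdeal} → w = vp := eq_of_mem_suppPF_of_not_mem_placesAboveFinset S θ W S₀ hS₀bad hbad hθunr hv hθ'θ hR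
  have hNP : ∀ n, ramificationSubgroup K (suppPF p 𝔣) ≤ (κ.restrictOfFinrankEqTwo hp K hK2).layerSubgroup n := ramificationSubgroup_suppPF_le_layerSubgroup (κ.restrictOfFinrankEqTwo hp K hK2) 𝔣
  have hθN : ∀ g ∈ ramificationSubgroup K (suppPF p 𝔣), θ' g = 1 := frame_eq_one_of_mem_ramificationSubgroup S hU
  have hPp : ∀ w : HeightOneSpectrum (𝓞 K), w ∉ (suppPF p 𝔣) → ((p : ℕ) : 𝓞 K) ∉ w.asIdeal := fun w hw hpw ↦ hw (hpv w hpw ▸ hvP)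
  have hS₀Kp : ∀ w ∈ {w : HeightOneSpectrum (𝓞 K) | ∃ v ∈ S₀, ((natGenerator v : ℕ) : 𝓞 K) ∈ w.asIdeal}, ((p : ℕ) : 𝓞 K) ∉ w.asIdeal := fun w hw hpw ↦ hvS₀ (hpv w hpw ▸ hw)
  have hns : AcSigned.IsNonsplitIn (κ.restrictOfFinrankEqTwo hp K hK2) vp := isNonsplitIn_restrictOfFinrankEqTwo hp hκ K hK2 hnd hvp
  have hTS : ∀ w ∈ T, w ∈ {w : HeightOneSpectrum (𝓞 K) | ∃ v ∈ S₀, ((natGenerator v : ℕ) : 𝓞 K) ∈ w.asIdeal} := fun w hw ↦ ((hT w).1 hw).1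
  -- N5-(i) in the frame (g26, p818290): `Π_{w∈S₀K} 𝐇¹_{Iw,w}` is finitely generated torsion
  obtain ⟨hfin, htors⟩ := moduleFinite_and_isTorsion_pi_semiloc_of_cyclotomic hp hK2 S hκ hγ hcv γK⁻¹ θ' (suppPF p 𝔣) hθN hPp {w : HeightOneSpectrum (𝓞 K) | ∃ v ∈ S₀, ((natGenerator v : ℕ) : 𝓞 K) ∈ w.asIdeal} hS₀Kfin hS₀Kp
  -- the depletion factors are non-zero (from `hgen` + torsion)
  have hP0 : ∀ w ∈ T, (iwasawaToIwasawaO S (PowerSeries.binomialSeries ℤ_[p] (x w)) -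
      PowerSeries.C (((θ' (φ w) : (padicCoeffIntegers S)ˣ) : padicCoeffIntegers S) *
        padicIntToCoeffIntegers S ((GaloisRep.cyclotomicCharacter K p (φ w) : ℤ_[p]ˣ) : ℤ_[p]))) ≠ 0 := by
    intro w hw
    obtain ⟨u, hann, -⟩ := hgen w hw
    exact ne_zero_of_annihilator_eq_span_of_isTorsion θ' (suppPF p 𝔣) htors (hTS w hw) u _ hann
  -- N5-(iii) from the generators (g26, p818109)
  have h1 := lambdaInvariant_quotient_span_le_unramifiedFamilies_of_generators S (κ.restrictOfFinrankEqTwo hp K hK2) γK⁻¹ θ' (suppPF p 𝔣) {w : HeightOneSpectrum (𝓞 K) | ∃ v ∈ S₀, ((natGenerator v : ℕ) : 𝓞 K) ∈ w.asIdeal} T hTS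
    (fun w ↦ iwasawaToIwasawaO S (PowerSeries.binomialSeries ℤ_[p] (x w)) -
      PowerSeries.C (((θ' (φ w) : (padicCoeffIntegers S)ˣ) : padicCoeffIntegers S) *
        padicIntToCoeffIntegers S ((GaloisRep.cyclotomicCharacter K p (φ w) : ℤ_[p]ˣ) : ℤ_[p])))
    hP0 d hfin htors (fun w hw ↦ (hgen w hw).imp fun u hu ↦ ⟨hu.1, fun _ ↦ hu.2⟩)
  -- a perfect `λ`, the local generator at the inert place, the pairings
  obtain ⟨lam, hlam, hinj, hsurj⟩ := exists_lam_perfect S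
  obtain ⟨γv, hγv⟩ := hns (Multiplicative.ofAdd 1)
  have hγv' : (κ.restrictOfFinrankEqTwo hp K hK2).IsTopGenerator (resGalOfEmb (closureEmb (K := K) (vp.adicCompletion K)) γv) := hγv
  have hperf : ∀ m : ℕ, Bijective fun a : ↥(torsionPow (Cofree θ (padicCoeffField S)) p m) ↦
      (cofreeLamCoeffPairingK S lam hlam θ' (suppPF p 𝔣) θ (GreenbergSelmer.isOpen_stabilizer_cofree S θ) hθ'θ m).toLin.flip a :=
    fun m ↦ bijective_flip_cofreeLamCoeffPairingK S lam hlam θ' (suppPF p 𝔣) θ (GreenbergSelmer.isOpen_stabilizer_cofree S θ) hθ'θ m hθN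
      (fun g hg ζ ↦ mu_apply_eq_self_of_mem_ramificationSubgroup (suppPF p 𝔣) hPp m hg ζ) (hinj m) (hsurj m)
  -- the Poitou–Tate half (g26, p816814)
  have h2 := lambdaInvariant_unramifiedFamilies_le S (κ.restrictOfFinrankEqTwo hp K hK2) γK θ' (suppPF p 𝔣) vp (Cofree θ (padicCoeffField S)) (GreenbergSelmer.isOpen_stabilizer_cofree S θ)
    (cofreeLamCoeffPairingK S lam hlam θ' (suppPF p 𝔣) θ (GreenbergSelmer.isOpen_stabilizer_cofree S θ) hθ'θ)
    (cofreeLamCoeffPairingK_hPred S lam hlam θ' (suppPF p 𝔣) θ (GreenbergSelmer.isOpen_stabilizer_cofree S θ) hθ'θ)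
    (cofreeLamCoeffPairingK_hPsc S lam hlam θ' (suppPF p 𝔣) θ (GreenbergSelmer.isOpen_stabilizer_cofree S θ) hθ'θ)
    (GreenbergSelmer.exists_pow_smul_cofree_eq_zero S θ) (W.baseChange K) j {w : HeightOneSpectrum (𝓞 K) | ∃ v ∈ S₀, ((natGenerator v : ℕ) : 𝓞 K) ∈ w.asIdeal} hS₀Kfin ε hvp hpv hns hγK
    ({w : HeightOneSpectrum (𝓞 K) | ∃ v ∈ S₀, ((natGenerator v : ℕ) : 𝓞 K) ∈ w.asIdeal} ∪ {w : HeightOneSpectrum (𝓞 K) | ((p : ℕ) : 𝓞 K) ∈ w.asIdeal}) Set.subset_union_left D hDtor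
    (layerPairingOf S (κ.restrictOfFinrankEqTwo hp K hK2) θ' (suppPF p 𝔣) vp (Cofree θ (padicCoeffField S))
      (isOpen_stabilizer_of_hres (Cofree θ (padicCoeffField S)) vp (fun _ _ ↦ rfl) (GreenbergSelmer.isOpen_stabilizer_cofree S θ))
      (cofreeLamCoeffPairing S lam hlam θ' (suppPF p 𝔣) vp θ (fun _ _ ↦ rfl)
        (isOpen_stabilizer_of_hres (Cofree θ (padicCoeffField S)) vp (fun _ _ ↦ rfl) (GreenbergSelmer.isOpen_stabilizer_cofree S θ)) hθ'θ)
      (GreenbergSelmer.exists_pow_smul_cofree_eq_zero S θ) γK⁻¹ γv (inv_mul_resGalOfEmb_mem_kerSubgroup hγK hγv') hNP hns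
      (cofreeLamCoeffPairing_hPred S lam hlam θ' (suppPF p 𝔣) vp θ (fun _ _ ↦ rfl)
        (isOpen_stabilizer_of_hres (Cofree θ (padicCoeffField S)) vp (fun _ _ ↦ rfl) (GreenbergSelmer.isOpen_stabilizer_cofree S θ)) hθ'θ)
      (cofreeLamCoeffPairing_hPsc S lam hlam θ' (suppPF p 𝔣) vp θ (fun _ _ ↦ rfl)
        (isOpen_stabilizer_of_hres (Cofree θ (padicCoeffField S)) vp (fun _ _ ↦ rfl) (GreenbergSelmer.isOpen_stabilizer_cofree S θ)) hθ'θ))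
    hvS₀ hvP hPfin hPS₀ hNP hperf I
    (fun n k f _ hy ↦ smul_mem_strictLevel S (κ.restrictOfFinrankEqTwo hp K hK2) θ' (suppPF p 𝔣) {w : HeightOneSpectrum (𝓞 K) | ∃ v ∈ S₀, ((natGenerator v : ℕ) : 𝓞 K) ∈ w.asIdeal} γK⁻¹ n k f hy) hfin htors
  exact h1.trans h2

end S3beta

end Summit.BirchSwinnertonDyer.BirchSwinnertonDyer.Theorems.SmallImageRttD2Seq

end
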